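import Mathlib
import HarnessLib
import Summits.NavierStokesRegularity.NavierStokesRegularity.Theorems.WakeRatchetMinimalViscousBlowupFrontClockAction

/-!
# Route `WakeRatchet`, crux `MinimalViscousBlowup` (stmt-NavierStokesRegularity-22743) — LINE g11-1 «threshold ray» (ns-idea-1 g11),
# stub S5 `stub_typeOneClock` REDUCED TO THE FRONT CLOCK: `typeOneClock_of_frontClock`

STUB-PLAN-typeOneClock.md, (C1)–(C2): S5 (type-I CLOCK `Λⁿ(T−t)‖X_n(t)‖ ≤ C'` and uniform per-shell ACTION `Λⁿ∫₀ᵀ‖X_n‖ ≤ C'`) follows from its own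
hypotheses (binders VERBATIM) plus the FRONT CLOCK (FC), stated first-firing-time free at the S4 level `c₀ = 1/(32768λ^{16})`:
`∃ K, ∀ m t, 0 ≤ t < T → (shell m quiet on [0,t], i.e. λ^m‖X_m(s)‖² < c₀ν² for s ≤ t) → T − t ≤ K/λ^{2m}`.
The residual of S5 is therefore exactly (FC) — the heart «front clock at threshold» of the plan ((C3), open).  `C' = max(K(√C + ν√c₀), (T+K)(√C + 4νλ²√c₀))`.
MODEL lattice ODEs only; nothing here concerns the Navier–Stokes equations (no NS regularity statement is proved).
`--supports stmt-NavierStokesRegularity-22743 --as helper`.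
[cite: Tao2016AveragedNS, §4 Lemma 4.1 (4.5), §5; BarbatoMorandinRomito2011, §3.1]
-/

noncomputable section

-- the summit and its single sub-problem share the name (CONVENTIONS §1)
set_option linter.dupNamespace false

open Set Filter Topology MeasureTheory

namespace Summit.NavierStokesRegularity.NavierStokesRegularity.Theorems.MinimalViscousBlowup.ThresholdRay

open Literature.Analysis.FluidPDE Literature.Analysis.FluidPDE.TaoCascade

/-- **S5 ⇐ (FC): `stub_typeOneClock` reduced to the front clock** (S5's binders VERBATIM, then the front-clock hypothesis, then S5's conclusion).
[cite: Tao2016AveragedNS, §4 Lemma 4.1 (4.5), §5; BarbatoMorandinRomito2011, §3.1] -/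
theorem typeOneClock_of_frontClock : ∀ ε₀ : ℝ, 0 < ε₀ → ∀ R : ℝ, 1 ≤ R →
    ∀ (α : Fin 4 → Fin 4 → Fin 4 → ℤ × ℤ × ℤ → ℝ) (X₀ : Fin 4 → ℝ),
    Literature.Analysis.FluidPDE.TaoCascade.InTableClass R α →
    ∀ (ν T C : ℝ) (X : Fin 4 → ℤ → ℝ → ℝ), 0 < ν → 0 < T →
    (∀ i n, ContDiffOn ℝ 1 (X i n) (Set.Ico 0 T)) →
    (∀ i n, X i n 0 = if n = 0 then X₀ i else 0) →
    (∀ i n t, n < 0 → X i n t = 0) →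
    (∀ i n t, 0 ≤ t → t < T → derivWithin (X i n) (Set.Ici 0) t =
      Literature.Analysis.FluidPDE.TaoCascade.quadTerm ε₀ α X i n t - ν * (1 + ε₀) ^ ((2 : ℝ) * n) * X i n t) →
    (∀ T' : ℝ, 0 < T' → T' < T → ∃ M : ℝ, ∀ t : ℝ, 0 ≤ t → t ≤ T' →
      ∀ (i : Fin 4) (n : ℤ), (1 + (1 + ε₀) ^ ((10 : ℝ) * n)) * |X i n t| ≤ M) →
    (∀ M : ℝ, ∃ t : ℝ, 0 ≤ t ∧ t < T ∧
      ∃ (i : Fin 4) (n : ℤ), M < (1 + (1 + ε₀) ^ ((10 : ℝ) * n)) * |X i n t|) →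
    (∀ (n : ℤ) (t : ℝ), 0 ≤ t → t < T →
      (1 + ε₀) ^ n * ‖Literature.Analysis.FluidPDE.TaoCascade.shellVec X n t‖ ^ 2 ≤ C) →
    -- (FC) the front clock at the S4 level `c₀ = 1/(32768 (1+ε₀)^16)`, first-firing-time free
    (∃ K : ℝ, ∀ (m : ℕ) (t : ℝ), 0 ≤ t → t < T →
      (∀ s, 0 ≤ s → s ≤ t →
        (1 + ε₀) ^ m * ‖Literature.Analysis.FluidPDE.TaoCascade.shellVec X m s‖ ^ 2 < 1 / (32768 * (1 + ε₀) ^ 16) * ν ^ 2) →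
      T - t ≤ K / (1 + ε₀) ^ (2 * m)) →
    ∃ C' : ℝ,
      (∀ (n : ℤ) (t : ℝ), 0 ≤ t → t < T →
        Literature.Analysis.FluidPDE.TaoCascade.bigLam ε₀ ^ n * (T - t) *
          ‖Literature.Analysis.FluidPDE.TaoCascade.shellVec X n t‖ ≤ C') ∧
      (∀ n : ℤ, MeasureTheory.IntegrableOn
          (fun t => ‖Literature.Analysis.FluidPDE.TaoCascade.shellVec X n t‖) (Set.Ico 0 T) ∧
        Literature.Analysis.FluidPDE.TaoCascade.bigLam ε₀ ^ n *
          (∫ t in Set.Ico 0 T, ‖Literature.Analysis.FluidPDE.TaoCascade.shellVec X n t‖) ≤ C') := by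
  intro ε₀ hε R _hR α X₀ hα ν T C X hν hT hcd hinit hlow hmot hreg _hblow henv hFC'
  obtain ⟨K, hFC⟩ := hFC'
  have hcan : IsCancellingCoeff α := hα.2.1
  have hα1 : ∀ i₁ i₂ i₃ : Fin 4, |α i₁ i₂ i₃ (0, 0, 1)| ≤ 1 := fun i₁ i₂ i₃ =>
    abs_le_one_of_inTableClass hα i₁ i₂ i₃ _ (by rw [mem_shiftSet_iff]; simp)
  have hclock := clock_of_frontClock hε hν hT hcan hα1 hcd hinit hlow hmot hreg henv hFC
  have haction := action_of_frontClock hε hν hT hcan hα1 hcd hinit hlow hmot hreg henv hFC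
  refine ⟨max (K * (Real.sqrt C + ν * Real.sqrt (1 / (32768 * (1 + ε₀) ^ 16))))
    ((T + K) * (Real.sqrt C + 4 * ν * (1 + ε₀) ^ 2 * Real.sqrt (1 / (32768 * (1 + ε₀) ^ 16)))), ?_, ?_⟩
  · exact fun n t ht0 htT => (hclock n t ht0 htT).trans (le_max_left _ _)
  · exact fun n => ⟨(haction n).1, (haction n).2.trans (le_max_right _ _)⟩

end Summit.NavierStokesRegularity.NavierStokesRegularity.Theorems.MinimalViscousBlowup.ThresholdRay

end
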